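import Summits.AtomisticToContinuum.BoseEinsteinCondensation.Theses.BECInsertionCorrector
import Summits.AtomisticToContinuum.BoseEinsteinCondensation.Theorems.CorrectorClosure.Negative.UndressedAnchorLoadBearing
import Summits.AtomisticToContinuum.BoseEinsteinCondensation.Theorems.CorrectorClosure.Negative.InsertionResidueHardCoreJamming
import Literature.MathematicalPhysics.QuantumManyBody.FubiniStudyAngle

/-!
# Negative lemmas for the stubs of line `llp-fidelity-arc` (crux `CorrectorClosure`,
stmt-AtomisticToContinuum-12058), v4 skeleton: rigidity and the existential stubs

Skeleton v4 (`Cruxes/CorrectorClosure/Lines/llp-fidelity-arc.lean`, lead's reshape of 2026-08-16 02:45Z) splits the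
physics into `stub_nearMinimiserRigidity` (G: at low density, eventually in `N`, the `δ`-near-minimisers at every
coupling collapse to one ray), `stub_undressedSpeedExists` (A∃) and `stub_dressedPathExists` (D∃) (existential
near-minimiser pairs within the prescribed Fubini–Study angle). Load-bearing analysis (drefute seat, 2026-08-16):

* `nearMinimiserRigidityOf_constOne_false` — FINITE RANGE IS LOAD-BEARING FOR (G): for the measurable, repulsive,
  infinite-range `v ≡ 1` every coupled energy with `N ≥ 2` is `⊤` (`coupledEnergy_constOne_eq_top`), every tagged state
  is a near-minimiser, and the constant state and a boosted condensate are at angle `π/2`; so the `N`-threshold of (G)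
  must come from finiteness of `E_λ(N, L_N)` (Ruelle at low density), its docstring's item (i).
* `nearMinimiserRigidityAllDensities_hardCore_false` — DILUTENESS IS LOAD-BEARING FOR (G): with `∀ ρ > 0` in place of
  `∃ ρ₀, ∀ ρ < ρ₀`, (G) fails for the admissible hard core of radius `1` at `ρ = 64`: the `N`-particle BATH in the
  `(N+1)`-box of side `((N+1)/64)^{1/3}` jams (pigeonhole `exists_close_pair` with `m = ⌈2L⌉`, `m³ ≤ 27(N+1)/64 < N`),
  so every coupled energy is `⊤` at every coupling (`coupledEnergy_hardCore_jammed_eq_top`).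
* `undressedSpeedExistsOf_constOne`, `dressedPathExistsOf_constOne` — by CONTRAST the existential stubs (A∃)/(D∃) are
  TRIVIALLY TRUE without finite range (`v ≡ 1`: take `Ψ = Ψ' =` the constant state, `fsAngle Ψ Ψ = 0`, majorant
  `s = 0`): the universal v2 anchor was `↔ ¬ StaticResponseBound` under the same weakening
  (`undressedSpeedWithoutFiniteRange_iff`), so the reshape moved the whole finite-range / finiteness load into (G); the
  content of (A∃)/(D∃) is carried only by `∀ δ > 0` at FINITE energies, where no common near-minimiser of `H_λ` and
  `H_{λ'}` exists below the second-order shift.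
-/

noncomputable section

open MeasureTheory Filter
open scoped ENNReal NNReal ComplexConjugate BigOperators

namespace Summit.AtomisticToContinuum.BoseEinsteinCondensation.Theorems.CorrectorClosure.Negative

open Literature.MathematicalPhysics.QuantumManyBody.BoseGas
open Summit.AtomisticToContinuum.BoseEinsteinCondensation.Theses.BECInsertionCorrector

/-! ## (G) without finite range is false -/

/-- The conclusion of `stub_nearMinimiserRigidity` for one potential `v` (v4 skeleton, verbatim). -/
def NearMinimiserRigidityOf (v : ℝ → ℝ≥0∞) : Prop :=
  ∃ ρ₀ : ℝ, 0 < ρ₀ ∧ ∀ ρ : ℝ, 0 < ρ → ρ < ρ₀ → ∀ᶠ N : ℕ in atTop,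
    ∀ lam ∈ Set.Icc (0 : ℝ) 1, ∀ ε : ℝ, 0 < ε →
      ∃ δ : ℝ≥0∞, 0 < δ ∧ ∀ Ψ Ψ' : TaggedPeriodicTrialState N (sideLength ρ (N + 1)),
        coupledEnergy v lam Ψ ≤ coupledGroundStateEnergy v lam N (sideLength ρ (N + 1)) + δ →
        coupledEnergy v lam Ψ' ≤ coupledGroundStateEnergy v lam N (sideLength ρ (N + 1)) + δ →
          fsAngle Ψ Ψ' ≤ ε

/-- **(G) fails for `v ≡ 1`** (measurable, repulsive, infinite range): at `λ = 0`, `ε = 1`, every density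
and every `N ≥ 2`, all states are near-minimisers and the constant state is at angle `π/2 > 1` from the
boosted condensate. Any proof of (G) must use `E_λ(N, L_N) < ⊤`. [folklore] -/
theorem nearMinimiserRigidityOf_constOne_false : ¬ NearMinimiserRigidityOf (fun _ => 1) := by
  rintro ⟨ρ₀, hρ₀, h⟩
  obtain ⟨N, h, hN2⟩ :=
    ((h (ρ₀ / 2) (by positivity) (by linarith)).and (Filter.eventually_ge_atTop 2)).exists
  obtain ⟨δ, _hδ, h⟩ := h 0 ⟨le_rfl, zero_le_one⟩ 1 one_pos
  have hL := sideLength_succ_pos (show (0 : ℝ) < ρ₀ / 2 by positivity) N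
  have key := h (TaggedPeriodicTrialState.const N hL) (planeWave (N + 1) hL e0).toTagged
    (by rw [coupledGroundStateEnergy_constOne_eq_top hN2]; exact le_top)
    (by rw [coupledGroundStateEnergy_constOne_eq_top hN2]; exact le_top)
  rw [fsAngle_const_planeWave N hL e0_ne_zero] at key
  linarith [Real.pi_gt_three]


/-! ## (G) at all densities is false: the bath jams (hard core, `ρ = 64`) -/

/-- In the `(N+1)`-box of side `L` with `2L ≤ m`, `m³ < N`, the `N` bath hard cores jam: every coupled tagged
energy is `⊤` (the bath–bath term alone). [folklore] -/
theorem coupledEnergy_hardCore_jammed_eq_top {N m : ℕ} {L : ℝ} (hL : 0 < L) (hm : 2 * L ≤ m)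
    (hcard : m ^ 3 < N) (lam : ℝ) (Ψ : TaggedPeriodicTrialState N L) :
    coupledEnergy hardCore lam Ψ = ⊤ := by
  have hmeas : Measurable fun X : Config (N + 1) => (‖Ψ.ψ X‖₊ : ℝ≥0∞) ^ 2 :=
    (Ψ.contDiff.continuous.measurable.nnnorm.coe_nnreal_ennreal.pow_const 2)
  refine top_le_iff.1 ?_
  calc (⊤ : ℝ≥0∞) = ⊤ * ∫⁻ X in cellN (N + 1) L, (‖Ψ.ψ X‖₊ : ℝ≥0∞) ^ 2 := by
        rw [Ψ.norm_eq, mul_one]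
    _ = ∫⁻ X in cellN (N + 1) L, ⊤ * (‖Ψ.ψ X‖₊ : ℝ≥0∞) ^ 2 := (lintegral_const_mul ⊤ hmeas).symm
    _ ≤ coupledEnergy hardCore lam Ψ := by
        unfold coupledEnergy
        refine setLIntegral_mono' (measurableSet_cellN (N + 1) L) fun X hX => ?_
        have htail : Matrix.vecTail X ∈ cellN N L := fun j => hX j.succ
        rw [periodicInteraction_hardCore_eq_top hL hm hcard (Matrix.vecTail X) htail, add_top]
        exact le_add_self

/-- (G) with `∀ ρ > 0` in place of `∃ ρ₀, ∀ ρ < ρ₀` (everything else verbatim). -/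
def NearMinimiserRigidityAllDensities (v : ℝ → ℝ≥0∞) : Prop :=
  ∀ ρ : ℝ, 0 < ρ → ∀ᶠ N : ℕ in atTop,
    ∀ lam ∈ Set.Icc (0 : ℝ) 1, ∀ ε : ℝ, 0 < ε →
      ∃ δ : ℝ≥0∞, 0 < δ ∧ ∀ Ψ Ψ' : TaggedPeriodicTrialState N (sideLength ρ (N + 1)),
        coupledEnergy v lam Ψ ≤ coupledGroundStateEnergy v lam N (sideLength ρ (N + 1)) + δ →
        coupledEnergy v lam Ψ' ≤ coupledGroundStateEnergy v lam N (sideLength ρ (N + 1)) + δ →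
          fsAngle Ψ Ψ' ≤ ε

/-- **Diluteness is load-bearing for (G)**: for the admissible hard core at `ρ = 64` the bath jams for all
large `N`, every state is a near-minimiser at every coupling, and the constant state is at angle `π/2` from the
boosted condensate. [folklore] -/
theorem nearMinimiserRigidityAllDensities_hardCore_false : ¬ NearMinimiserRigidityAllDensities hardCore := by
  intro h
  obtain ⟨N, h, hN⟩ := ((h 64 (by norm_num)).and (Filter.eventually_ge_atTop 63)).exists
  have hρ : (0 : ℝ) < 64 := by norm_num
  have hL := sideLength_succ_pos hρ N
  set L := sideLength 64 (N + 1) with hLdef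
  have hL3 : L ^ 3 = ((N : ℝ) + 1) / 64 := sideLength_succ_pow_three hρ N
  have hL1 : 1 ≤ L := by
    have h1 : (1 : ℝ) ≤ L ^ 3 := by
      rw [hL3, le_div_iff₀ hρ]
      have : (63 : ℝ) ≤ N := by exact_mod_cast hN
      linarith
    by_contra hlt
    push Not at hlt
    have : L ^ 3 < 1 ^ 3 := pow_lt_pow_left₀ hlt hL.le (by norm_num)
    linarith
  set m : ℕ := ⌈2 * L⌉₊ with hm
  have hm2 : 2 * L ≤ m := Nat.le_ceil _
  have hmlt : (m : ℝ) < 2 * L + 1 := Nat.ceil_lt_add_one (by positivity)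
  have hm3L : (m : ℝ) ≤ 3 * L := by linarith
  have hcardR : (m : ℝ) ^ 3 < (N : ℝ) := by
    have : (m : ℝ) ^ 3 ≤ (3 * L) ^ 3 := pow_le_pow_left₀ (by positivity) hm3L 3
    have hN' : (63 : ℝ) ≤ N := by exact_mod_cast hN
    nlinarith [hL3, this, hL1]
  have hcard : m ^ 3 < N := by exact_mod_cast hcardR
  have hE0 : ∀ lam : ℝ, coupledGroundStateEnergy hardCore lam N L = ⊤ := fun lam =>
    iInf_eq_top.2 fun Ψ => coupledEnergy_hardCore_jammed_eq_top hL hm2 hcard lam Ψ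
  obtain ⟨δ, _hδ, h⟩ := h 0 ⟨le_rfl, zero_le_one⟩ 1 one_pos
  have key := h (TaggedPeriodicTrialState.const N hL) (planeWave (N + 1) hL e0).toTagged
    (by rw [hE0]; exact le_top) (by rw [hE0]; exact le_top)
  rw [fsAngle_const_planeWave N hL e0_ne_zero] at key
  linarith [Real.pi_gt_three]

/-! ## (A∃) and (D∃) without finite range are trivially true -/


/-- The conclusion of `stub_undressedSpeedExists` for one potential `v` (v4 skeleton, verbatim). -/
def UndressedSpeedExistsOf (v : ℝ → ℝ≥0∞) : Prop :=
  ∀ θ : ℝ, 0 < θ → ∃ ρ₀ : ℝ, 0 < ρ₀ ∧ ∀ ρ : ℝ, 0 < ρ → ρ < ρ₀ → ∀ᶠ N : ℕ in atTop,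
    ∃ η : ℝ, 0 < η ∧ ∀ lam' ∈ Set.Icc (0 : ℝ) 1, lam' ≠ 0 → |lam' - 0| < η →
      ∀ δ : ℝ≥0∞, 0 < δ → ∃ Ψ Ψ' : TaggedPeriodicTrialState N (sideLength ρ (N + 1)),
        coupledEnergy v 0 Ψ ≤ coupledGroundStateEnergy v 0 N (sideLength ρ (N + 1)) + δ ∧
        coupledEnergy v lam' Ψ' ≤ coupledGroundStateEnergy v lam' N (sideLength ρ (N + 1)) + δ ∧
          fsAngle Ψ Ψ' ≤ θ * lam'

/-- The conclusion of `stub_dressedPathExists` for one potential `v` (v4 skeleton, verbatim). -/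
def DressedPathExistsOf (v : ℝ → ℝ≥0∞) : Prop :=
  ∀ θ : ℝ, 0 < θ →
    ∃ ρ₀ : ℝ, 0 < ρ₀ ∧ ∀ ρ : ℝ, 0 < ρ → ρ < ρ₀ → ∀ᶠ N : ℕ in atTop,
      ∃ s : ℝ → ℝ, IntegrableOn s (Set.Icc (0 : ℝ) 1) ∧ (∀ t, 0 ≤ s t) ∧
        (∫ t in Set.Icc (0 : ℝ) 1, s t) ≤ θ ∧
        ∀ lam ∈ Set.Icc (0 : ℝ) 1,
          ∃ η : ℝ, 0 < η ∧ ∀ lam' ∈ Set.Icc (0 : ℝ) 1, lam' ≠ lam → |lam' - lam| < η →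
            ∀ δ : ℝ≥0∞, 0 < δ → ∃ Ψ Ψ' : TaggedPeriodicTrialState N (sideLength ρ (N + 1)),
              coupledEnergy v lam Ψ ≤ coupledGroundStateEnergy v lam N (sideLength ρ (N + 1)) + δ ∧
              coupledEnergy v lam' Ψ' ≤
                coupledGroundStateEnergy v lam' N (sideLength ρ (N + 1)) + δ ∧
                fsAngle Ψ Ψ' ≤ ∫ t in Set.uIcc lam lam', s t

/-- **(A∃) holds trivially for `v ≡ 1`**: every state is a near-minimiser at every coupling, so the
constant state paired with itself (angle `0`) witnesses the existential. [folklore] -/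
theorem undressedSpeedExistsOf_constOne : UndressedSpeedExistsOf (fun _ => 1) := by
  intro θ hθ
  refine ⟨1, one_pos, fun ρ hρ _ => ?_⟩
  filter_upwards [Filter.eventually_ge_atTop 2] with N hN2
  refine ⟨1, one_pos, fun lam' hlam' _ _ δ _ => ?_⟩
  have hL := sideLength_succ_pos hρ N
  refine ⟨TaggedPeriodicTrialState.const N hL, TaggedPeriodicTrialState.const N hL, ?_, ?_, ?_⟩
  · rw [coupledGroundStateEnergy_constOne_eq_top hN2]; exact le_top
  · rw [coupledGroundStateEnergy_constOne_eq_top hN2]; exact le_top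
  · rw [fsAngle_self]
    exact mul_nonneg hθ.le hlam'.1

/-- **(D∃) holds trivially for `v ≡ 1`**, with the zero majorant. [folklore] -/
theorem dressedPathExistsOf_constOne : DressedPathExistsOf (fun _ => 1) := by
  intro θ hθ
  refine ⟨1, one_pos, fun ρ hρ _ => ?_⟩
  filter_upwards [Filter.eventually_ge_atTop 2] with N hN2
  refine ⟨fun _ => 0, integrableOn_zero, fun _ => le_rfl, ?_, fun lam _ => ?_⟩
  · simp only [integral_zero]; exact hθ.le
  · refine ⟨1, one_pos, fun lam' _ _ _ δ _ => ?_⟩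
    have hL := sideLength_succ_pos hρ N
    refine ⟨TaggedPeriodicTrialState.const N hL, TaggedPeriodicTrialState.const N hL, ?_, ?_, ?_⟩
    · rw [coupledGroundStateEnergy_constOne_eq_top hN2]; exact le_top
    · rw [coupledGroundStateEnergy_constOne_eq_top hN2]; exact le_top
    · rw [fsAngle_self]; simp

end Summit.AtomisticToContinuum.BoseEinsteinCondensation.Theorems.CorrectorClosure.Negative

end
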